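import Mathlib
import Summits.KontsevichZagierPeriods.Zeta5Search.DualSeriesDecompositionNine
import HarnessLib

/-!
# `F̃₉(b)`: CANONICAL coefficients of `ζ(7), ζ(5), ζ(3), 1` and the decomposition along rays
# (cell `pub-zeta5`, PROVER 3 — `k = 9` port of the coefficient layer of `WedgeDictionary.lean` and of `DualSeriesScaling.lean`)

HONEST FRAMING: systematic search; no irrationality claim unless certified.

`DualSeriesDecompositionNine.vwpDual_nine_mem` gives `F̃₉(b) = u ζ(7) + w ζ(5) + x ζ(3) − v` with SOME rationals. For
certificates (integer forms `ℓ n : Fin 4 → ℤ`, denominators, minors) the coefficients must be NAMED functions of `b`.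
As in the typer's `WedgeDictionary.lean` (`k = 7`: `coeffU/W/V`), they are defined through the UNIQUE partial-fraction
data of the summand `R_b(t) = numPoly_b(t+1)/(t+1)_{b₀+1}^8` (`DualSeriesNine.term_eq`):

* `IsPFData9 b c` (`c_{o,p}`, `o < 8`, `p ≤ b₀`), uniqueness `IsPFData9.eq` (`BallRivoal.pf_unique`), existence
  `exists_isPFData9` on the box with `Σ_j b_j ≤ 4b₀ + 2` (Cresson–Fischler–Rivoal), a choice `pfData9`;
* `coeff7 b = Σ_p c_{6,p}`, `coeff5 b = Σ_p c_{4,p}`, `coeff3 b = Σ_p c_{2,p}`,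
  `coeff0 b = Σ_{o<8} Σ_p c_{o,p} H_p^{(o+1)}` and their choice-independence (`coeff7_eq`, …);
* `sum_pfData9_odd` — the odd orders (coefficients of `ζ(2), ζ(4), ζ(6), ζ(8)`) vanish by the reflection;
* **`vwp9_decomposition`**: on the box with `Σ_j b_j ≤ 4b₀ + 2`,
  `F̃₉(b) = coeff7 b · ζ(7) + coeff5 b · ζ(5) + coeff3 b · ζ(3) − coeff0 b` (THEOREM; no linear independence of zeta
  values is used: the coefficients are defined by partial fractions, not by the value);
* RAYS (port of `DualSeriesScaling`): `inBox9_nsmul`, `sum9_nsmul_le`, **`vwpDual_nine_nsmul_eq`** — for `0 ≤ b₀`,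
  `0 ≤ b_j ≤ b₀`, `Σ_j b_j ≤ 4b₀` and EVERY `n : ℕ`, `F̃₉(n·b)` is the four-term form with the canonical coefficients;
  `base9`/`ray9`/`vwpDual_nine_ray_eq` (rays in coordinates) and kernel instances for `fam-vwp`'s rays `β = (3;1⁹)`,
  `(16; 3,3,4,4,5,5,6,6,7)`, `(20; 5,6,6,7,7,8,8,9,9)` (`families/vwp/FAMILY.md`).
Everything is PROVED (0 sorry); no denominator or arithmetic statement is claimed.
-/

noncomputable section

open Finset Polynomial

namespace Summit.KontsevichZagierPeriods.Zeta5Search.DualSeriesNine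

open Literature.NumberTheory.Irrationality.BrownZudilin2022 (vwpDual)
open Literature.NumberTheory.Irrationality.CressonFischlerRivoal2008 (poch exists_pf_data sum_pf_data_odd
  hasSum_of_pf_data)
open Literature.NumberTheory.Transcendental (zetaValue)
open Literature.NumberTheory.Transcendental.BallRivoal (pfEval harm pf_unique pfEval_sub')

/-! ### Canonical partial-fraction coefficients of `F̃₉(b)` -/

/-- `c` is partial-fraction data of the summand `R_b(t) = numPoly_b(t+1)/(t+1)_{b₀+1}^8` of (34) (`k = 9`):
`R_b(t) = Σ_{p ≤ b₀} Σ_{o < 8} c_{o,p}/(t+p+1)^{o+1}` away from the poles. -/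
def IsPFData9 (b : ℕ → ℤ) (c : ℕ → ℕ → ℚ) : Prop :=
  ∀ t : ℚ, (∀ p, p ≤ (b 0).toNat → t + p + 1 ≠ 0) →
    pfEval (b 0).toNat 8 c t =
      ((numPoly b).comp (X + C 1)).eval t /
        Literature.NumberTheory.Transcendental.BallRivoal.poch (t + 1) ((b 0).toNat + 1) ^ 8

/-- UNIQUENESS of partial-fraction data on their support (`o < 8`, `p ≤ b₀`). -/
theorem IsPFData9.eq {b : ℕ → ℤ} {c c' : ℕ → ℕ → ℚ} (hc : IsPFData9 b c) (hc' : IsPFData9 b c')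
    {o p : ℕ} (ho : o < 8) (hp : p ≤ (b 0).toNat) : c o p = c' o p := by
  have h := pf_unique (b 0).toNat 8 (fun o p => c o p - c' o p) 0 (fun t _ => by
    have hpole : ∀ p, p ≤ (b 0).toNat → (t : ℚ) + p + 1 ≠ 0 := fun p _ => by positivity
    rw [pfEval_sub', hc _ hpole, hc' _ hpole, sub_self]) o p ho hp
  exact sub_eq_zero.1 h

open Classical in
/-- A CHOICE of partial-fraction data (junk `0` if none exists; see `exists_isPFData9`). -/
def pfData9 (b : ℕ → ℤ) : ℕ → ℕ → ℚ :=
  if h : ∃ c, IsPFData9 b c then Classical.choose h else fun _ _ => 0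

/-- The chosen data are partial-fraction data as soon as some exist. -/
theorem isPFData9_pfData9 {b : ℕ → ℤ} {c : ℕ → ℕ → ℚ} (hc : IsPFData9 b c) : IsPFData9 b (pfData9 b) := by
  have h : ∃ c, IsPFData9 b c := ⟨c, hc⟩
  rw [pfData9, dif_pos h]
  exact Classical.choose_spec h

/-- CANONICAL coefficient of `ζ(7)`: `Σ_{p ≤ b₀} c_{6,p}`. -/
def coeff7 (b : ℕ → ℤ) : ℚ := ∑ p ∈ range ((b 0).toNat + 1), pfData9 b 6 p

/-- CANONICAL coefficient of `ζ(5)`: `Σ_{p ≤ b₀} c_{4,p}`. -/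
def coeff5 (b : ℕ → ℤ) : ℚ := ∑ p ∈ range ((b 0).toNat + 1), pfData9 b 4 p

/-- CANONICAL coefficient of `ζ(3)`: `Σ_{p ≤ b₀} c_{2,p}`. -/
def coeff3 (b : ℕ → ℤ) : ℚ := ∑ p ∈ range ((b 0).toNat + 1), pfData9 b 2 p

/-- CANONICAL constant term: `Σ_{o<8} Σ_{p ≤ b₀} c_{o,p} · H_p^{(o+1)}` (`H_p^{(i)} = BallRivoal.harm i p`). -/
def coeff0 (b : ℕ → ℤ) : ℚ :=
  ∑ o ∈ range 8, ∑ p ∈ range ((b 0).toNat + 1), pfData9 b o p * harm (o + 1) p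

/-- `coeff7 b` computed from ANY partial-fraction data. -/
theorem coeff7_eq {b : ℕ → ℤ} {c : ℕ → ℕ → ℚ} (hc : IsPFData9 b c) :
    coeff7 b = ∑ p ∈ range ((b 0).toNat + 1), c 6 p :=
  sum_congr rfl fun p hp => (isPFData9_pfData9 hc).eq hc (by norm_num) (Nat.lt_succ_iff.1 (mem_range.1 hp))

/-- `coeff5 b` computed from ANY partial-fraction data. -/
theorem coeff5_eq {b : ℕ → ℤ} {c : ℕ → ℕ → ℚ} (hc : IsPFData9 b c) :
    coeff5 b = ∑ p ∈ range ((b 0).toNat + 1), c 4 p :=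
  sum_congr rfl fun p hp => (isPFData9_pfData9 hc).eq hc (by norm_num) (Nat.lt_succ_iff.1 (mem_range.1 hp))

/-- `coeff3 b` computed from ANY partial-fraction data. -/
theorem coeff3_eq {b : ℕ → ℤ} {c : ℕ → ℕ → ℚ} (hc : IsPFData9 b c) :
    coeff3 b = ∑ p ∈ range ((b 0).toNat + 1), c 2 p :=
  sum_congr rfl fun p hp => (isPFData9_pfData9 hc).eq hc (by norm_num) (Nat.lt_succ_iff.1 (mem_range.1 hp))

/-- `coeff0 b` computed from ANY partial-fraction data. -/
theorem coeff0_eq {b : ℕ → ℤ} {c : ℕ → ℕ → ℚ} (hc : IsPFData9 b c) :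
    coeff0 b = ∑ o ∈ range 8, ∑ p ∈ range ((b 0).toNat + 1), c o p * harm (o + 1) p :=
  sum_congr rfl fun o ho => sum_congr rfl fun p hp => by
    rw [(isPFData9_pfData9 hc).eq hc (mem_range.1 ho) (Nat.lt_succ_iff.1 (mem_range.1 hp))]

/-! ### Existence of the data and the decomposition with canonical coefficients -/

/-- The degree hypothesis of Cresson–Fischler–Rivoal (`A = 8`, `n = b₀`) on the box with `Σ_j b_j ≤ 4b₀ + 2`. -/
theorem natDegree_numPoly_add_two_le9 (b : ℕ → ℤ) (hb : InBox b)
    (hsum : ∑ j ∈ range 9, b (j + 1) ≤ 4 * b 0 + 2) :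
    (numPoly b).natDegree + 2 ≤ 8 * ((b 0).toNat + 1) := by
  obtain ⟨h0, hj⟩ := hb
  have hb0 : (b 0 : ℤ) = ((b 0).toNat : ℤ) := (Int.toNat_of_nonneg h0).symm
  have hS : ∑ j ∈ range 9, b (j + 1) = ((∑ j ∈ range 9, (b (j + 1)).toNat : ℕ) : ℤ) := by
    rw [Nat.cast_sum]
    exact sum_congr rfl fun j hj' => (Int.toNat_of_nonneg (hj j hj').1).symm
  have h1 := natDegree_numPoly_le b
  have h2 : ((∑ j ∈ range 9, (b (j + 1)).toNat : ℕ) : ℤ) ≤ 4 * ((b 0).toNat : ℤ) + 2 := by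
    rw [← hS, ← hb0]; exact hsum
  omega

/-- EXISTENCE of partial-fraction data on the box with `Σ_j b_j ≤ 4b₀ + 2`. -/
theorem exists_isPFData9 (b : ℕ → ℤ) (hb : InBox b) (hsum : ∑ j ∈ range 9, b (j + 1) ≤ 4 * b 0 + 2) :
    ∃ c, IsPFData9 b c := by
  have hdeg := natDegree_numPoly_add_two_le9 b hb hsum
  have hQ : ((numPoly b).comp (X + C 1)).degree < ((8 * ((b 0).toNat + 1) : ℕ) : WithBot ℕ) := by
    have hnat : ((numPoly b).comp (X + C 1)).natDegree = (numPoly b).natDegree := by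
      rw [natDegree_comp, natDegree_X_add_C, mul_one]
    exact degree_le_natDegree.trans_lt (by rw [hnat]; exact_mod_cast (by omega))
  exact exists_pf_data (b 0).toNat 8 (by norm_num) _ hQ

/-- The series (34) (`k = 9`) summed through ANY partial-fraction data `c` of `R_b`:
`Σ_μ term b μ = (Σ_p c_{6,p}) ζ(7) + (Σ_p c_{4,p}) ζ(5) + (Σ_p c_{2,p}) ζ(3) − Σ_{o,p} c_{o,p} H_p^{(o+1)}`. -/
theorem hasSum_term_pf9 (b : ℕ → ℤ) (hb : InBox b) (hsum : ∑ j ∈ range 9, b (j + 1) ≤ 4 * b 0 + 2)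
    {c : ℕ → ℕ → ℚ} (hc : IsPFData9 b c) :
    HasSum (term b)
      ((∑ p ∈ range ((b 0).toNat + 1), (c 6 p : ℝ)) * zetaValue 7 +
        (∑ p ∈ range ((b 0).toNat + 1), (c 4 p : ℝ)) * zetaValue 5 +
        (∑ p ∈ range ((b 0).toNat + 1), (c 2 p : ℝ)) * zetaValue 3 -
        ∑ o ∈ range 8, ∑ p ∈ range ((b 0).toNat + 1), (c o p : ℝ) * (harm (o + 1) p : ℝ)) := by
  have hdeg := natDegree_numPoly_add_two_le9 b hb hsum
  have hS := hasSum_of_pf_data (b 0).toNat 8 (numPoly b) (by norm_num) hdeg (numPoly_reflect b hb) c hc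
  have hfun : term b = fun k : ℕ => aeval ((k : ℝ) + 1) (numPoly b) / poch (k + 1) (b 0).toNat ^ 8 :=
    funext fun k => term_eq b hb k
  rw [hfun]
  convert hS using 1
  rw [filter_odd_Icc_three_eight, sum_insert (by decide), sum_pair (by norm_num)]
  simp only [Nat.reduceSub]
  ring

/-- The odd orders carry nothing: `Σ_p c_{o,p} = 0` for odd `o < 8` (coefficients of `ζ(2), ζ(4), ζ(6), ζ(8)`). -/
theorem sum_pfData9_odd (b : ℕ → ℤ) (hb : InBox b) {c : ℕ → ℕ → ℚ} (hc : IsPFData9 b c)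
    {o : ℕ} (ho : o < 8) (hodd : Odd o) : ∑ p ∈ range ((b 0).toNat + 1), c o p = 0 :=
  sum_pf_data_odd (b 0).toNat 8 (numPoly b) (numPoly_reflect b hb) c hc o ho hodd

/-- **DECOMPOSITION with the canonical coefficients (`k = 9`)**: on the box with `Σ_j b_j ≤ 4b₀ + 2` the series
(34) converges to `coeff7 b · ζ(7) + coeff5 b · ζ(5) + coeff3 b · ζ(3) − coeff0 b`, and this is `F̃₉(b)`. -/
theorem vwp9_decomposition (b : ℕ → ℤ) (hb : InBox b) (hsum : ∑ j ∈ range 9, b (j + 1) ≤ 4 * b 0 + 2) :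
    HasSum (term b) ((coeff7 b : ℝ) * zetaValue 7 + (coeff5 b : ℝ) * zetaValue 5 +
        (coeff3 b : ℝ) * zetaValue 3 - (coeff0 b : ℝ)) ∧
      vwpDual 9 b = (coeff7 b : ℝ) * zetaValue 7 + (coeff5 b : ℝ) * zetaValue 5 +
        (coeff3 b : ℝ) * zetaValue 3 - (coeff0 b : ℝ) := by
  obtain ⟨c, hc⟩ := exists_isPFData9 b hb hsum
  have h := hasSum_term_pf9 b hb hsum hc
  rw [coeff7_eq hc, coeff5_eq hc, coeff3_eq hc, coeff0_eq hc]
  push_cast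
  exact ⟨h, by rw [vwpDual_nine_eq_tsum, h.tsum_eq]⟩

/-! ### Rays `n·b` -/

/-- Scaling preserves the box: `0 ≤ b₀`, `0 ≤ b_j ≤ b₀` ⇒ `n·b` is in the box for every `n : ℕ`. -/
theorem inBox9_nsmul (b : ℕ → ℤ) (h0 : 0 ≤ b 0) (hb : ∀ j ∈ range 9, 0 ≤ b (j + 1) ∧ b (j + 1) ≤ b 0) (n : ℕ) :
    InBox (fun j => (n : ℤ) * b j) := by
  have hn : (0 : ℤ) ≤ n := Nat.cast_nonneg n
  refine ⟨mul_nonneg hn h0, fun j hj => ⟨?_, ?_⟩⟩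
  · show 0 ≤ (n : ℤ) * b (j + 1)
    exact mul_nonneg hn (hb j hj).1
  · show (n : ℤ) * b (j + 1) ≤ (n : ℤ) * b 0 + 1
    nlinarith [(hb j hj).2, (hb j hj).1, mul_le_mul_of_nonneg_left (hb j hj).2 hn]

/-- Scaling preserves the sum condition in the form needed: `Σ_j n·b_j ≤ 4·(n·b₀) + 2`. -/
theorem sum9_nsmul_le (b : ℕ → ℤ) (hsum : ∑ j ∈ range 9, b (j + 1) ≤ 4 * b 0) (n : ℕ) :
    ∑ j ∈ range 9, (n : ℤ) * b (j + 1) ≤ 4 * ((n : ℤ) * b 0) + 2 := by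
  rw [← mul_sum]
  nlinarith [hsum, (Nat.cast_nonneg n : (0 : ℤ) ≤ n)]

/-- **The decomposition along a ray (`k = 9`)**: for `b` with `0 ≤ b₀`, `0 ≤ b_j ≤ b₀`, `Σ_j b_j ≤ 4b₀` and every
`n : ℕ`, the series (34) at `n·b` converges and `F̃₉(n·b) = coeff7·ζ(7) + coeff5·ζ(5) + coeff3·ζ(3) − coeff0` with the
canonical coefficients at `n·b` — the whole family is a family of four-term forms in `1, ζ(3), ζ(5), ζ(7)`. -/
theorem vwpDual_nine_nsmul_eq (b : ℕ → ℤ) (h0 : 0 ≤ b 0)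
    (hb : ∀ j ∈ range 9, 0 ≤ b (j + 1) ∧ b (j + 1) ≤ b 0) (hsum : ∑ j ∈ range 9, b (j + 1) ≤ 4 * b 0) (n : ℕ) :
    HasSum (term fun j => (n : ℤ) * b j)
        ((coeff7 (fun j => (n : ℤ) * b j) : ℝ) * zetaValue 7 + (coeff5 (fun j => (n : ℤ) * b j) : ℝ) * zetaValue 5 +
          (coeff3 (fun j => (n : ℤ) * b j) : ℝ) * zetaValue 3 - (coeff0 (fun j => (n : ℤ) * b j) : ℝ)) ∧
      vwpDual 9 (fun j => (n : ℤ) * b j) =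
        (coeff7 (fun j => (n : ℤ) * b j) : ℝ) * zetaValue 7 + (coeff5 (fun j => (n : ℤ) * b j) : ℝ) * zetaValue 5 +
          (coeff3 (fun j => (n : ℤ) * b j) : ℝ) * zetaValue 3 - (coeff0 (fun j => (n : ℤ) * b j) : ℝ) :=
  vwp9_decomposition _ (inBox9_nsmul b h0 hb n) (sum9_nsmul_le b hsum n)

/-- The base point of a ray as a function `ℕ → ℤ`: `j ↦ β_j` for `j ≤ 9`, `0` beyond. -/
def base9 (β : Fin 10 → ℤ) : ℕ → ℤ := fun j => if h : j < 10 then β ⟨j, h⟩ else 0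

/-- The ray `n·β`: `j ↦ n·β_j`. -/
def ray9 (β : Fin 10 → ℤ) (n : ℕ) : ℕ → ℤ := fun j => (n : ℤ) * base9 β j

/-- **Rays in coordinates**: for `β = (β₀; β₁,…,β₉)` with `0 ≤ β₀`, `0 ≤ β_j ≤ β₀`, `Σ_j β_j ≤ 4β₀` (decidable), and
every `n`, `F̃₉(n·β) = coeff7·ζ(7) + coeff5·ζ(5) + coeff3·ζ(3) − coeff0` at `n·β`. -/
theorem vwpDual_nine_ray_eq (β : Fin 10 → ℤ) (h0 : 0 ≤ base9 β 0)
    (hb : ∀ j ∈ range 9, 0 ≤ base9 β (j + 1) ∧ base9 β (j + 1) ≤ base9 β 0)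
    (hsum : ∑ j ∈ range 9, base9 β (j + 1) ≤ 4 * base9 β 0) (n : ℕ) :
    vwpDual 9 (ray9 β n) =
      (coeff7 (ray9 β n) : ℝ) * zetaValue 7 + (coeff5 (ray9 β n) : ℝ) * zetaValue 5 +
        (coeff3 (ray9 β n) : ℝ) * zetaValue 3 - (coeff0 (ray9 β n) : ℝ) :=
  (vwpDual_nine_nsmul_eq (base9 β) h0 hb hsum n).2

/-- `fam-vwp`'s RAY 1, `β = (3; 1⁹)` (`families/vwp/FAMILY.md`): for every `n`, `F̃₉(n·β)` is the canonical
four-term form in `1, ζ(3), ζ(5), ζ(7)` (hypotheses decided by the kernel). -/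
theorem vwpDual_nine_ray_three_ones (n : ℕ) :
    vwpDual 9 (ray9 ![3, 1, 1, 1, 1, 1, 1, 1, 1, 1] n) =
      (coeff7 (ray9 ![3, 1, 1, 1, 1, 1, 1, 1, 1, 1] n) : ℝ) * zetaValue 7 +
        (coeff5 (ray9 ![3, 1, 1, 1, 1, 1, 1, 1, 1, 1] n) : ℝ) * zetaValue 5 +
        (coeff3 (ray9 ![3, 1, 1, 1, 1, 1, 1, 1, 1, 1] n) : ℝ) * zetaValue 3 -
        (coeff0 (ray9 ![3, 1, 1, 1, 1, 1, 1, 1, 1, 1] n) : ℝ) :=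
  vwpDual_nine_ray_eq _ (by decide) (by decide) (by decide) n

/-- `fam-vwp`'s ray `β = (16; 3,3,4,4,5,5,6,6,7)`: for every `n`, `F̃₉(n·β)` is the canonical four-term form. -/
theorem vwpDual_nine_ray_sixteen (n : ℕ) :
    vwpDual 9 (ray9 ![16, 3, 3, 4, 4, 5, 5, 6, 6, 7] n) =
      (coeff7 (ray9 ![16, 3, 3, 4, 4, 5, 5, 6, 6, 7] n) : ℝ) * zetaValue 7 +
        (coeff5 (ray9 ![16, 3, 3, 4, 4, 5, 5, 6, 6, 7] n) : ℝ) * zetaValue 5 +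
        (coeff3 (ray9 ![16, 3, 3, 4, 4, 5, 5, 6, 6, 7] n) : ℝ) * zetaValue 3 -
        (coeff0 (ray9 ![16, 3, 3, 4, 4, 5, 5, 6, 6, 7] n) : ℝ) :=
  vwpDual_nine_ray_eq _ (by decide) (by decide) (by decide) n

/-- Brown–Zudilin's Sect. 12 / Zudilin's `q = 11`-type symmetric ray `β = (20; 5,6,6,7,7,8,8,9,9)` (fam-vwp's list):
for every `n`, `F̃₉(n·β)` is the canonical four-term form. -/
theorem vwpDual_nine_ray_twenty (n : ℕ) :
    vwpDual 9 (ray9 ![20, 5, 6, 6, 7, 7, 8, 8, 9, 9] n) =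
      (coeff7 (ray9 ![20, 5, 6, 6, 7, 7, 8, 8, 9, 9] n) : ℝ) * zetaValue 7 +
        (coeff5 (ray9 ![20, 5, 6, 6, 7, 7, 8, 8, 9, 9] n) : ℝ) * zetaValue 5 +
        (coeff3 (ray9 ![20, 5, 6, 6, 7, 7, 8, 8, 9, 9] n) : ℝ) * zetaValue 3 -
        (coeff0 (ray9 ![20, 5, 6, 6, 7, 7, 8, 8, 9, 9] n) : ℝ) :=
  vwpDual_nine_ray_eq _ (by decide) (by decide) (by decide) n

end Summit.KontsevichZagierPeriods.Zeta5Search.DualSeriesNine
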